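import Summits.QuantumAdvantage.QuantumAdvantage.Theorems.SymplecticPurityGraphStateSpectrum

/-!
# Fibres of the exponential map on an `n`-bit register (crux `DlogGraphFlat`, item stmt-QuantumAdvantage-10732)

If `g` has multiplicative order `p − 1` modulo the prime `p` and `2ⁿ ≤ 2(p − 1)`, then every
value of `x ↦ (g : ZMod p) ^ (Nat.ofBits x)` on registers `x : QReg n` is taken at most twice
(`stub_dlogOrbitFibre`, the fibre bound used by the differential-count assembly of the line
`Sketch` of the crux `DlogGraphFlat`).

Proof. `gᵃ = gᵇ → a % (p − 1) = b % (p − 1)` (`IsOfFinOrder.pow_inj_mod`, the order being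
`p − 1 > 0`), and `Nat.ofBits` is injective with values `< 2ⁿ ≤ 2(p − 1)`; so on one fibre the
quotient `Nat.ofBits x / (p − 1) ∈ {0, 1}` already determines `x`, i.e. the fibre injects into
`Finset.range 2`.
-/

set_option linter.dupNamespace false -- D-0017: single-problem summit ⇒ `QuantumAdvantage.QuantumAdvantage` by design

namespace Summit.QuantumAdvantage.QuantumAdvantage.Theorems.SymplecticPurity

open Finset Literature.Computability.QuantumComplexity Literature.Computability.Cryptography

/-- **Fibres of the exponential map.** If `g` has order `p − 1` modulo the prime `p` and
`2ⁿ ≤ 2(p − 1)`, every value is taken by `x ↦ g^{ofBits x}` (`x : QReg n`) at most twice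
(`gᵃ = gᵇ ↔ a ≡ b [MOD p−1]`, and a residue class mod `p − 1` meets `[0, 2ⁿ)` at most twice).
[folklore] -/
theorem stub_dlogOrbitFibre : ∀ (n p g : ℕ), p.Prime → orderOf (g : ZMod p) = p - 1 →
    2 ^ n ≤ 2 * (p - 1) → ∀ Y : ZMod p,
    (Finset.univ.filter fun x : QReg n => (g : ZMod p) ^ Nat.ofBits x = Y).card ≤ 2 := by
  intro n p g hp hord hn Y
  have hp1 : 0 < p - 1 := by have := hp.two_le; omega
  have hfin : IsOfFinOrder (g : ZMod p) := by rw [← orderOf_pos_iff, hord]; exact hp1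
  -- equal powers have equal residues mod `p - 1`
  have hmod : ∀ a b : ℕ, (g : ZMod p) ^ a = (g : ZMod p) ^ b → a % (p - 1) = b % (p - 1) := by
    intro a b hab
    have h := hfin.pow_inj_mod.mp hab
    rwa [hord] at h
  calc (Finset.univ.filter fun x : QReg n => (g : ZMod p) ^ Nat.ofBits x = Y).card
      ≤ (Finset.range 2).card := by
        refine Finset.card_le_card_of_injOn (fun x => Nat.ofBits x / (p - 1)) ?_ ?_
        · -- the quotient is `< 2` since `Nat.ofBits x < 2ⁿ ≤ 2(p − 1)`
          intro x _
          have hx : Nat.ofBits x < 2 ^ n := Nat.ofBits_lt_two_pow x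
          have hlt : Nat.ofBits x / (p - 1) < 2 :=
            Nat.div_lt_of_lt_mul (by rw [Nat.mul_comm]; exact lt_of_lt_of_le hx hn)
          simpa only [Finset.coe_range, Set.mem_Iio] using hlt
        · -- same quotient and (by `hmod`) same residue ⇒ same value of `Nat.ofBits` ⇒ same register
          intro x hx x' hx' hq
          have hxY : (g : ZMod p) ^ Nat.ofBits x = Y := by simpa using hx
          have hx'Y : (g : ZMod p) ^ Nat.ofBits x' = Y := by simpa using hx'
          have hr : Nat.ofBits x % (p - 1) = Nat.ofBits x' % (p - 1) :=
            hmod _ _ (hxY.trans hx'Y.symm)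
          have hv : Nat.ofBits x = Nat.ofBits x' := by
            rw [← Nat.mod_add_div (Nat.ofBits x) (p - 1), ← Nat.mod_add_div (Nat.ofBits x') (p - 1),
              hr]
            exact congrArg (fun q => Nat.ofBits x' % (p - 1) + (p - 1) * q) hq
          funext t
          have h := congrArg (fun v => v.testBit t.val) hv
          simpa using h
    _ = 2 := Finset.card_range 2

end Summit.QuantumAdvantage.QuantumAdvantage.Theorems.SymplecticPurity
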